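import Summits.NavierStokesRegularity.NavierStokesRegularity.Theorems.FastClassSqueeze.Negative.FalseKinematic
import Summits.NavierStokesRegularity.NavierStokesRegularity.Theorems.FastClassSqueeze.Negative.StubPointSqueezeOfSubscaleFalse

/-!
# `FastClassSqueeze` is not kinematic, part 3: neither is `FastGradientSerrinStarved` (X₂ of the BC2 split)

Negative-side support for the crux `FastClassSqueeze` (stmt-NavierStokesRegularity-15832, route
`HodographBetchov`, rank 3) and for its BC2 split inside the closes cone
(`NoFastEnergyConcentration` X₁ = stmt-18118, `FastGradientSerrinStarved` X₂ = stmt-18120, glue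
`FastClassSqueezeOfSubs` = stmt-18129): refuter crux-disprover cycle 1 (2026-08-17). Theorems only;
nothing here asserts a Theses statement.

`fastGradientSerrinStarved_false_kinematic`: the self-similar-rate collapsing blob of parts 1–2
(`KinematicBlob.lean`, `FalseKinematic.lean`: smooth, divergence free, compactly supported, finite
non-increasing energy, finite dissipation, Type-I rate, bounded `L³`) ALSO satisfies the conclusion of
X₁ for itself — it is energy-starved at infinite speed (`blob_noFastEnergyConcentration`: near the
collapse its total energy `√(1−t)∫|U|²` is already `≤ ε`, before that it is bounded and the fast class
above the bound is empty) — and yet its fast-class GRADIENT Serrin functional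
`∫₀¹ (∫_{|u|>l} ‖∇u‖^q)^{2/(2q−3)}` is infinite for every `l > 0`, `q > 3/2` (on the fast biaxial core
`‖∇u‖ = λ²‖B‖ ≥ λ²`; the operator norm majorises the min–max majorant, `opNorm_plane_majorant`, so the
core lower bound of part 2 applies verbatim). So the implication "X₁-conclusion ⇒ X₂-conclusion" is
NOT kinematic: X₂, not X₁, carries the regularity strength of the crux (as its planner's note says),
and any proof of X₂ must be dynamic (it must exclude the fast biaxial Type-I collapse; e.g. ESS
backward uniqueness is the kind of input available, since the witness is even `L^∞_t L³_x`).
[cite: MajdaBertozzi2002, §1.4 (exact solutions with linear velocity field)]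
-/

noncomputable section

-- the summit and its single problem share the name `NavierStokesRegularity` (D-0017 nested layout)
set_option linter.dupNamespace false

namespace Summit.NavierStokesRegularity.NavierStokesRegularity.Theorems.FastClassSqueeze.Negative

open MeasureTheory Set Filter Metric Topology Function InnerProductSpace
open scoped ENNReal NNReal RealInnerProductSpace ContDiff
open Literature.Analysis.FluidPDE

/-! ## Corollary for the BC2 split: `FastGradientSerrinStarved` (X₂) is not kinematic either -/

/-- The operator norm majorises the quadratic form of `∇(slice)` on every 2-plane (Cauchy–Schwarz on
the frame `e₀, e₁`): the min–max clause of the crux holds with `m := ‖∇u‖`. [folklore] -/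
theorem opNorm_plane_majorant (L : EuclideanSpace ℝ (Fin 3) →L[ℝ] EuclideanSpace ℝ (Fin 3)) :
    ∃ v w : EuclideanSpace ℝ (Fin 3), ‖v‖ = 1 ∧ ‖w‖ = 1 ∧ ⟪v, w⟫ = 0 ∧
      ∀ α β : ℝ, ⟪L (α • v + β • w), α • v + β • w⟫ ≤ ‖L‖ * (α ^ 2 + β ^ 2) := by
  refine ⟨ex, ey, by simp [ex], by simp [ey], inner_ex_ey, fun α β => ?_⟩
  calc ⟪L (α • ex + β • ey), α • ex + β • ey⟫
      ≤ ‖L (α • ex + β • ey)‖ * ‖α • ex + β • ey‖ := real_inner_le_norm _ _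
    _ ≤ ‖L‖ * ‖α • ex + β • ey‖ * ‖α • ex + β • ey‖ := by
        gcongr
        exact L.le_opNorm _
    _ = ‖L‖ * (α ^ 2 + β ^ 2) := by rw [mul_assoc, ← sq, norm_combo_sq]

/-- **The blob is energy-starved at infinite speed** (it satisfies the conclusion of
`NoFastEnergyConcentration`, X₁): for every `ε > 0` some level `l` bounds the fast-class energy by
`ε` at ALL times — near the collapse the TOTAL energy `√(1−t)∫|U|²` is already `≤ ε`, before that the
field is bounded and the fast class above that bound is empty. [folklore] -/
theorem blob_noFastEnergyConcentration {ε : ℝ} (hε : 0 < ε) :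
    ∃ l : ℝ, 0 < l ∧ ∀ t ∈ Ico (0 : ℝ) 1,
      ∫⁻ x in {x : EuclideanSpace ℝ (Fin 3) | l < ‖blob t x‖}, ‖blob t x‖ₑ ^ 2 ≤ ENNReal.ofReal ε := by
  obtain ⟨M, hM⟩ := blob_typeI
  set E : ℝ≥0∞ := ∫⁻ x, ‖biaxProfile x‖ₑ ^ 2 with hE
  have hEtop : E ≠ ⊤ := lintegral_biaxProfile_sq_lt_top.ne
  set Er : ℝ := E.toReal with hEr
  have hEr0 : 0 ≤ Er := ENNReal.toReal_nonneg
  -- the late window `[t₁, 1)`: total energy `≤ ε`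
  set δ : ℝ := ε / (Er + 1) with hδ
  have hδ0 : 0 < δ := div_pos hε (by linarith)
  set t₁ : ℝ := max 0 (1 - δ ^ 2) with ht₁
  have ht₁0 : 0 ≤ t₁ := le_max_left _ _
  have ht₁1 : t₁ < 1 := max_lt one_pos (by nlinarith)
  -- the early window `[0, t₁)`: the field is bounded by `L`
  set L : ℝ := |M| / Real.sqrt (1 - t₁) with hL
  have hsq1 : 0 < Real.sqrt (1 - t₁) := Real.sqrt_pos.2 (by linarith)
  refine ⟨max L 1, lt_max_of_lt_right one_pos, fun t ht => ?_⟩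
  rcases lt_or_ge t t₁ with htt | htt
  · -- early: the fast class is empty
    have hempty : {x : EuclideanSpace ℝ (Fin 3) | max L 1 < ‖blob t x‖} = ∅ := by
      refine Set.eq_empty_of_forall_notMem fun x hx => ?_
      have h1 : ‖blob t x‖ ≤ M / Real.sqrt (1 - t) := hM t ht x
      have h2 : M / Real.sqrt (1 - t) ≤ L := by
        have hst : Real.sqrt (1 - t₁) ≤ Real.sqrt (1 - t) := Real.sqrt_le_sqrt (by linarith)
        calc M / Real.sqrt (1 - t) ≤ |M| / Real.sqrt (1 - t) :=
              div_le_div_of_nonneg_right (le_abs_self M) (hsq1.trans_le hst).le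
          _ ≤ |M| / Real.sqrt (1 - t₁) := div_le_div_of_nonneg_left (abs_nonneg M) hsq1 hst
      exact absurd (lt_of_le_of_lt (le_max_left L 1) hx) (not_lt.2 (h1.trans h2))
    rw [hempty, Measure.restrict_empty, lintegral_zero_measure]
    exact bot_le
  · -- late: bound by the total energy `√(1−t) E ≤ δ (Er + 1) = ε`
    have ht1 : t < 1 := ht.2
    have hδt : Real.sqrt (1 - t) ≤ δ := by
      have h1 : 1 - t ≤ δ ^ 2 := by
        have : 1 - δ ^ 2 ≤ t₁ := le_max_right _ _
        linarith
      calc Real.sqrt (1 - t) ≤ Real.sqrt (δ ^ 2) := Real.sqrt_le_sqrt h1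
        _ = δ := Real.sqrt_sq hδ0.le
    calc ∫⁻ x in {x : EuclideanSpace ℝ (Fin 3) | max L 1 < ‖blob t x‖}, ‖blob t x‖ₑ ^ 2
        ≤ ∫⁻ x, ‖blob t x‖ₑ ^ 2 := setLIntegral_le_lintegral _ _
      _ = ENNReal.ofReal (Real.sqrt (1 - t)) * E := by
          rw [blob, lintegral_blobSlice_sq (rate_pos ht1), rate_inv]
      _ ≤ ENNReal.ofReal δ * ENNReal.ofReal Er := by
          rw [ENNReal.ofReal_toReal hEtop]
          exact mul_le_mul_of_nonneg_right (ENNReal.ofReal_le_ofReal hδt) bot_le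
      _ = ENNReal.ofReal (δ * Er) := (ENNReal.ofReal_mul hδ0.le).symm
      _ ≤ ENNReal.ofReal ε := ENNReal.ofReal_le_ofReal (by
          rw [hδ, div_mul_eq_mul_div, div_le_iff₀ (by linarith)]
          nlinarith)

/-- **`FastGradientSerrinStarved` (X₂ of the BC2 split) is not kinematic either, even GIVEN the
conclusion of `NoFastEnergyConcentration` (X₁) for the same field**: the blob is energy-starved at
infinite speed (`blob_noFastEnergyConcentration`), smooth, divergence free, compactly supported, in
the energy class with non-increasing energy and finite dissipation, Type-I, bounded in `L³`, yet its
fast-class GRADIENT Serrin functional `∫₀¹(∫_{|u|>l}‖∇u‖^q)^{2/(2q−3)}` is infinite for every `l > 0`,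
`q > 3/2` (`‖∇u‖ = λ²‖B‖ ≥ λ²` on the fast biaxial core). So X₂, not X₁, carries the regularity
strength of the crux, and its proof must be dynamic. [folklore] -/
theorem fastGradientSerrinStarved_false_kinematic :
    ¬ (∀ (T : ℝ), 0 < T →
      ∀ (u : ℝ → EuclideanSpace ℝ (Fin 3) → EuclideanSpace ℝ (Fin 3)),
        IsSmoothSpaceTimeOn (Set.Ico 0 T) u →
        (∀ t ∈ Set.Ico 0 T, VectorCalculus.IsDivFree (u t)) →
        (∀ t ∈ Set.Ico 0 T, HasCompactSupport (u t)) →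
        (∀ t ∈ Set.Ico 0 T, ∫⁻ x, ‖u t x‖ₑ ^ 2 < ⊤) →
        (∀ s ∈ Set.Ico 0 T, ∀ t ∈ Set.Ico 0 T, s ≤ t → ∫⁻ x, ‖u t x‖ₑ ^ 2 ≤ ∫⁻ x, ‖u s x‖ₑ ^ 2) →
        (∫⁻ t in Set.Ioo 0 T, ∫⁻ x, ‖fderiv ℝ (u t) x‖ₑ ^ 2 < ⊤) →
        (∃ M : ℝ, ∀ t ∈ Set.Ico 0 T, ∀ x, ‖u t x‖ ≤ M / Real.sqrt (T - t)) →
        (∃ C : ℝ≥0∞, C < ⊤ ∧ ∀ t ∈ Set.Ico 0 T, ∫⁻ x, ‖u t x‖ₑ ^ 3 ≤ C) →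
        (∀ ε : ℝ, 0 < ε → ∃ l : ℝ, 0 < l ∧ ∀ t ∈ Set.Ico 0 T,
          ∫⁻ x in {x : EuclideanSpace ℝ (Fin 3) | l < ‖u t x‖}, ‖u t x‖ₑ ^ 2 ≤ ENNReal.ofReal ε) →
        ∃ l : ℝ, 0 < l ∧ ∃ q : ℝ, 3 / 2 < q ∧
          ∫⁻ t in Set.Ioo 0 T, (∫⁻ x in {x : EuclideanSpace ℝ (Fin 3) | l < ‖u t x‖},
            ENNReal.ofReal ‖fderiv ℝ (u t) x‖ ^ q) ^ (2 / (2 * q - 3)) < ⊤) := by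
  intro h
  obtain ⟨l, -, q, hq, hint⟩ := h 1 one_pos blob blob_isSmoothSpaceTimeOn
    (fun t _ => blob_isDivFree t) (fun t ht => blob_hasCompactSupport ht.2)
    (fun t ht => blob_energy_lt_top ht.2) (fun s _ t ht hst => blob_energy_antitone ht.2 hst)
    blob_dissipation_lt_top blob_typeI blob_critical (fun ε hε => blob_noFastEnergyConcentration hε)
  have he : 0 < 2 / (2 * q - 3) := div_pos two_pos (by linarith)
  have hq0 : 0 ≤ q := by linarith
  set R : ℝ := max (4 * l) 1 with hR
  have hR1 : 1 ≤ R := le_max_right _ _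
  have hR0 : 0 < R := by linarith
  set t₀ : ℝ := 1 - (R ^ 2)⁻¹ with ht₀
  have ht₀0 : 0 ≤ t₀ := by
    have : (R ^ 2)⁻¹ ≤ 1 := inv_le_one_of_one_le₀ (by nlinarith)
    linarith
  have ht₀1 : t₀ < 1 := by
    have : 0 < (R ^ 2)⁻¹ := by positivity
    linarith
  have hrate : ∀ t ∈ Ioo t₀ 1, R ≤ rate t := by
    intro t ht
    have h1t : 0 < 1 - t := by linarith [ht.2]
    have h2 : 1 - t ≤ (R ^ 2)⁻¹ := by linarith [ht.1]
    have h3 : Real.sqrt (1 - t) ≤ R⁻¹ :=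
      (Real.sqrt_le_sqrt h2).trans_eq (by rw [← inv_pow, Real.sqrt_sq (inv_nonneg.2 hR0.le)])
    calc R = (R⁻¹)⁻¹ := (inv_inv R).symm
      _ ≤ (Real.sqrt (1 - t))⁻¹ := inv_anti₀ (Real.sqrt_pos.2 h1t) h3
  set K : ℝ≥0∞ := (ENNReal.ofReal ((4 : ℝ)⁻¹ ^ 3) * volume (ball (0 : EuclideanSpace ℝ (Fin 3)) 1)) ^
    (2 / (2 * q - 3)) with hK
  have hB0 : ENNReal.ofReal ((4 : ℝ)⁻¹ ^ 3) * volume (ball (0 : EuclideanSpace ℝ (Fin 3)) 1) ≠ 0 :=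
    mul_ne_zero (ENNReal.ofReal_pos.2 (by positivity)).ne' (measure_ball_pos volume _ one_pos).ne'
  have hBtop : ENNReal.ofReal ((4 : ℝ)⁻¹ ^ 3) * volume (ball (0 : EuclideanSpace ℝ (Fin 3)) 1) ≠ ⊤ :=
    ENNReal.mul_ne_top ENNReal.ofReal_ne_top measure_ball_lt_top.ne
  have hK0 : K ≠ 0 := (ENNReal.rpow_pos (pos_iff_ne_zero.2 hB0) hBtop).ne'
  have hKtop : K ≠ ⊤ := ENNReal.rpow_ne_top_of_nonneg he.le hBtop
  have hG : ∀ t ∈ Ioo t₀ 1, ENNReal.ofReal ((1 - t)⁻¹) * K ≤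
      (∫⁻ x in {x : EuclideanSpace ℝ (Fin 3) | l < ‖blob t x‖},
        ENNReal.ofReal ‖fderiv ℝ (blob t) x‖ ^ q) ^ (2 / (2 * q - 3)) := by
    intro t ht
    have ht1 : t < 1 := ht.2
    have hc : 0 < rate t := rate_pos ht1
    have hcl : 4 * l ≤ rate t := (le_max_left _ _).trans (hrate t ht)
    have h1 := core_inner_lower hc hcl hq0 (μ := fun y => ‖fderiv ℝ (blob t) y‖)
      (fun y _ => opNorm_plane_majorant (fderiv ℝ (blobSlice (rate t)) y))
    have h2 := ENNReal.rpow_le_rpow h1 he.le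
    rw [core_rpow_identity hc hq, rate_sq ht1] at h2
    exact h2
  have hI : ∫⁻ t in Ioo t₀ 1, ENNReal.ofReal ((1 - t)⁻¹) * K = ⊤ := by
    rw [lintegral_mul_const' _ _ hKtop, lintegral_inv_one_sub_eq_top ht₀1, ENNReal.top_mul hK0]
  have h3 := (setLIntegral_mono' measurableSet_Ioo hG).trans
    (lintegral_mono_set (μ := volume) (Ioo_subset_Ioo_left ht₀0))
  rw [hI, top_le_iff] at h3
  exact (lt_top_iff_ne_top.1 hint) h3

end Summit.NavierStokesRegularity.NavierStokesRegularity.Theorems.FastClassSqueeze.Negative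

end
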